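import Literature.Combinatorics.Enumerative.MultivariateAperyNumbers
import Mathlib.NumberTheory.Padics.PadicIntegers
import Mathlib.NumberTheory.Padics.RingHoms
import Mathlib.Tactic
import HarnessLib

/-!
# Osburn–Sahu–Straub 2016, Lemma 2.2 (8) and the half-block splitting of the weights `k⁻²` by `[2k/p^s]`

Topic `Literature/Combinatorics/Enumerative`, namespace `Literature.Combinatorics.Enumerative.SporadicSupercongruenceProofs`
(sibling of `SporadicSupercongruenceTermProofs`; feeds `…GZeroProofs` → `…Proofs`, which DISCHARGES the named fact
`AperyGaussCongruences.oss2016_theorem12`). PROOF FILE: sorry-free theorems only — no definition, no named fact.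
Source read on the page (held `paper:arxiv-1312.2195`, §2 pp. 5–6): R. Osburn, B. Sahu, A. Straub, *Supercongruences
for sporadic sequences*, Proc. Edinb. Math. Soc. **59** (2016) 503–518 [OsburnSahuStraub2016]. HONEST FRAMING (cell
pub-zeta5): classical `p`-adic congruences for power sums and binomial sums; nothing here concerns `ζ(5)`.

## What is printed (verbatim, [OsburnSahuStraub2016] §2)

«Lemma 2.2. Let `p` be a prime and `n` an integer such that `n ≢ 0` modulo `p − 1`. Then, for all integers `r ≥ 0`,
(7) `Σ'_{k=1}^{p^r−1} k^n ≡ 0 (mod p^r)`. If, additionally, `n` is even, then, for primes `p ≥ 5`,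
(8) `Σ'_{k=1}^{(p^r−1)/2} 1/k^n ≡ 0 (mod p^r)`. Proof. … Congruence (8) follows since the sum in (8), modulo `p^r`,
is exactly half of the sum in (7) if `n` is even.» (`Σ'` = sum over indices not divisible by `p`.)
Proof of Theorem 1.2, the splitting by `[2k/p^s]`: «If we now let `{k : p^s} := k − p^s[k/p^s]`, the remainder of
`k` divided by `p^s`, then observe that `[2k/p^s] = 2[k/p^s] + 1` if `{k : p^s} > p^s/2`, and `= 2[k/p^s]` otherwise.
Hence, (sumCsx) `Σ'_k (1/k²) 𝒞(mp^{r−s}, [k/p^s], [2k/p^s]) = Σ_n 𝒞(mp^{r−s}, n, 2n) Σ'_{[k/p^s]=n, {k:p^s}<p^s/2} 1/k²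
+ Σ_n 𝒞(mp^{r−s}, n, 2n+1) Σ'_{[k/p^s]=n, {k:p^s}>p^s/2} 1/k²`. It follows from (8) of Lemma 2.2 that each of the
inner sums in the last expression is divisible by `p^s`.»

## Rendering and what is proved (`n = −2`, `p ≥ 5`)

The weights `a_k = 1/k²` (`p ∤ k`), `0` (`p ∣ k`) live in Mathlib's `ℤ_[p]` as `(Ring.inverse k)²` (as in the tree's
`MultivariateAperyGZeroProofs`); (8) is read in `ℤ/p^s` with `1/k` the inverse of the unit `k`, and transported to the
block `[k/p^s] = n` along `PadicInt.toZModPow s`.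
* `half_sum_inv_sq_eq_zero` — (8) for `n = −2`: `Σ_{k ≤ (p^s−1)/2, p∤k} k⁻² = 0` in `ℤ/p^s` (`s ≥ 1`), from the
  tree's full sum `MultivariateAperyNumbers.sum_range_inv_sq_eq_zero` ((7), Straub's Lemma 5.2) by the printed
  «exactly half» reflection `k ↦ p^s − k` and `2` a unit;
* `pow_dvd_sum_weights_lower_half` / `…_upper_half` — «each of the inner sums … is divisible by `p^s`»;
* `sum_range_mul_eq_sum_sum`, `add_div_pow_eq`, `two_mul_add_div_pow_eq` — the regrouping `Σ_k = Σ_n Σ_{[k/p^s]=n}`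
  and the printed digit identity for `[2k/p^s]`;
* **`pow_dvd_weighted_block_sum`** — the abstract form of one step of the printed induction: if `p^e ∣ G(n, j)` for
  all `n, j`, then `p^{e+s} ∣ Σ_{k < Mp^s} a_k · G([k/p^s], [2k/p^s])`.
-/

open Finset

namespace Literature.Combinatorics.Enumerative.SporadicSupercongruenceProofs

open MultivariateAperyNumbers (sum_range_inv_sq_eq_zero)

/-! ### §1. Lemma 2.2 (8): the half power sum in `ℤ/p^s` -/

section HalfSum

variable {p : ℕ} [hp : Fact p.Prime]

/-- `k` prime to `p` is a unit modulo `p^s`. [folklore] -/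
private theorem isUnit_natCast_zmod_of_not_dvd (s : ℕ) {k : ℕ} (hk : ¬ p ∣ k) :
    IsUnit ((k : ZMod (p ^ s))) := by
  rw [ZMod.isUnit_iff_coprime]
  exact Nat.Coprime.pow_right _ (Nat.coprime_comm.mp ((Nat.Prime.coprime_iff_not_dvd hp.out).mpr hk))

/-- Inverse of a negated unit in `ZMod n`. [folklore] -/
private theorem inv_neg_of_isUnit_zmod {n : ℕ} {x : ZMod n} (hx : IsUnit x) : (-x)⁻¹ = -x⁻¹ := by
  obtain ⟨u, rfl⟩ := hx
  rw [← Units.val_neg, ZMod.inv_coe_unit, ZMod.inv_coe_unit, inv_neg, Units.val_neg]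

/-- Reflection: if `g(0) = 0` and `g(2h+1−j) = g(j)` for `1 ≤ j ≤ h`, then `Σ_{k<2h+1} g(k) = 2 Σ_{k ≤ h} g(k)`.
[folklore] -/
private theorem sum_range_eq_two_mul_half_oss {R : Type*} [CommRing R] (g : ℕ → R) (h : ℕ) (hg0 : g 0 = 0)
    (hrefl : ∀ j, 1 ≤ j → j ≤ h → g (2 * h + 1 - j) = g j) :
    ∑ k ∈ range (2 * h + 1), g k = 2 * ∑ k ∈ range (h + 1), g k := by
  rw [show 2 * h + 1 = (h + 1) + h by ring, Finset.sum_range_add]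
  have h2 : ∑ x ∈ range h, g (h + 1 + x) = ∑ k ∈ range (h + 1), g k := by
    rw [← Finset.sum_range_reflect (fun x => g (h + 1 + x)) h]
    rw [Finset.sum_range_succ' g h, hg0, add_zero]
    apply Finset.sum_congr rfl
    intro i hi
    rw [mem_range] at hi
    have : h + 1 + (h - 1 - i) = 2 * h + 1 - (i + 1) := by omega
    rw [this, hrefl (i + 1) (by omega) (by omega)]
  rw [h2]; ring

/-- **Osburn–Sahu–Straub 2016, Lemma 2.2, (8) for `n = −2`**: for a prime `p ≥ 5` and `s ≥ 1`,
`Σ'_{k=1}^{(p^s−1)/2} 1/k² ≡ 0 (mod p^s)`, read in `ℤ/p^s` (the terms `p ∣ k` replaced by `0`; `(p^s−1)/2 = [p^s/2]`).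
Printed route: «exactly half of the sum in (7)» — the full sum vanishes (tree `sum_range_inv_sq_eq_zero`), the
reflection `k ↦ p^s − k` preserves `k⁻²`, and `2` is a unit. [cite: OsburnSahuStraub2016, Lemma 2.2 (8)] -/
theorem half_sum_inv_sq_eq_zero (h5 : 5 ≤ p) {s : ℕ} (hs : 1 ≤ s) :
    ∑ k ∈ range (p ^ s / 2 + 1), (if p ∣ k then (0 : ZMod (p ^ s)) else ((k : ZMod (p ^ s))⁻¹) ^ 2) = 0 := by
  have hp' := hp.out
  have hp2 : p ≠ 2 := by omega
  obtain ⟨h, hh⟩ : Odd (p ^ s) := (hp'.odd_of_ne_two hp2).pow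
  have hhalf : p ^ s / 2 = h := by omega
  set g : ℕ → ZMod (p ^ s) := fun k => if p ∣ k then 0 else ((k : ZMod (p ^ s))⁻¹) ^ 2 with hg
  have hfull : ∑ k ∈ range (2 * h + 1), g k = 0 := by
    rw [← hh]; exact sum_range_inv_sq_eq_zero (p := p) h5 s
  have hg0 : g 0 = 0 := by simp [hg]
  have hrefl : ∀ j, 1 ≤ j → j ≤ h → g (2 * h + 1 - j) = g j := by
    intro j hj1 hjh
    have hjle : j ≤ 2 * h + 1 := by omega
    have hdvd : p ∣ (2 * h + 1 - j) ↔ p ∣ j := by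
      have hpn : p ∣ 2 * h + 1 := by rw [← hh]; exact dvd_pow_self p (by omega)
      constructor
      · intro hd
        have := Nat.dvd_sub hpn hd
        rwa [Nat.sub_sub_self hjle] at this
      · intro hd; exact Nat.dvd_sub hpn hd
    simp only [hg, hdvd]
    by_cases hpj : p ∣ j
    · simp [hpj]
    · rw [if_neg hpj, if_neg hpj, Nat.cast_sub hjle]
      have : ((2 * h + 1 : ℕ) : ZMod (p ^ s)) = 0 := by rw [← hh, ZMod.natCast_self]
      rw [this, zero_sub, inv_neg_of_isUnit_zmod (isUnit_natCast_zmod_of_not_dvd s hpj), neg_sq]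
  have htwo := sum_range_eq_two_mul_half_oss g h hg0 hrefl
  rw [hfull] at htwo
  have h2u : IsUnit ((2 : ℕ) : ZMod (p ^ s)) :=
    isUnit_natCast_zmod_of_not_dvd s (fun hd => by have := Nat.le_of_dvd two_pos hd; omega)
  have h2 : ((2 : ℕ) : ZMod (p ^ s)) = 2 := by push_cast; rfl
  rw [h2] at h2u
  rw [hhalf]
  exact (h2u.mul_right_eq_zero).mp htwo.symm

end HalfSum

/-! ### §2. The weights `a_k = k⁻²` in `ℤ_p` and their half-block sums -/

section Weights

variable {p : ℕ} [hp : Fact p.Prime]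

omit hp in
/-- A natural number is a unit of `ℤ_p` iff it is prime to `p`. [folklore] -/
private theorem isUnit_natCast_padicInt_iff_oss [Fact p.Prime] (K : ℕ) : IsUnit ((K : ℤ_[p])) ↔ ¬ p ∣ K := by
  rw [PadicInt.isUnit_iff, ← PadicInt.norm_natCast_lt_one_iff (p := p)]
  have := PadicInt.norm_le_one ((K : ℤ_[p]))
  constructor
  · intro h; rw [h]; exact lt_irrefl 1
  · intro h; exact le_antisymm this (not_lt.mp h)

/-- `Ring.inverse k = 0` in `ℤ_p` for `p ∣ k`. [folklore] -/
private theorem ringInverse_natCast_of_dvd_oss {K : ℕ} (hK : p ∣ K) : Ring.inverse ((K : ℤ_[p])) = 0 :=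
  Ring.inverse_non_unit _ (fun h => (isUnit_natCast_padicInt_iff_oss K).mp h hK)

/-- Reduction modulo `p^s` commutes with `Ring.inverse` on natural numbers (`s ≥ 1`). [folklore] -/
private theorem toZModPow_ringInverse_natCast_oss {s : ℕ} (hs : 1 ≤ s) (K : ℕ) :
    PadicInt.toZModPow s (Ring.inverse ((K : ℤ_[p]))) = Ring.inverse ((K : ZMod (p ^ s))) := by
  by_cases hK : p ∣ K
  · rw [ringInverse_natCast_of_dvd_oss hK, map_zero, Ring.inverse_non_unit]
    intro hu
    rw [ZMod.isUnit_iff_coprime, Nat.coprime_pow_right_iff (by omega), Nat.coprime_comm,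
      Nat.Prime.coprime_iff_not_dvd hp.out] at hu
    exact hu hK
  · obtain ⟨u, hu⟩ := (isUnit_natCast_padicInt_iff_oss K).mpr hK
    set ψ : ℤ_[p] →* ZMod (p ^ s) := (PadicInt.toZModPow s).toMonoidHom with hψ
    have hval : ((Units.map ψ u : (ZMod (p ^ s))ˣ) : ZMod (p ^ s)) = (K : ZMod (p ^ s)) := by
      rw [Units.coe_map, hψ, RingHom.toMonoidHom_eq_coe, MonoidHom.coe_coe, hu, map_natCast]
    calc PadicInt.toZModPow s (Ring.inverse ((K : ℤ_[p])))
        = ψ ((u⁻¹ : ℤ_[p]ˣ) : ℤ_[p]) := by rw [← hu, Ring.inverse_unit]; rfl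
      _ = ((Units.map ψ u)⁻¹ : (ZMod (p ^ s))ˣ) := (Units.coe_map_inv ψ u).symm
      _ = Ring.inverse ((Units.map ψ u : (ZMod (p ^ s))ˣ) : ZMod (p ^ s)) := (Ring.inverse_unit _).symm
      _ = Ring.inverse ((K : ZMod (p ^ s))) := by rw [hval]

/-- In `ℤ/p^s` (`s ≥ 1`), `(Ring.inverse k)² = k⁻²` for `p ∤ k` and `0` for `p ∣ k`. [folklore] -/
private theorem ringInverse_natCast_zmod_sq {s : ℕ} (hs : 1 ≤ s) (K : ℕ) :
    (Ring.inverse ((K : ZMod (p ^ s)))) ^ 2 = if p ∣ K then 0 else ((K : ZMod (p ^ s))⁻¹) ^ 2 := by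
  by_cases hK : p ∣ K
  · rw [if_pos hK, Ring.inverse_non_unit, zero_pow two_ne_zero]
    intro hu
    rw [ZMod.isUnit_iff_coprime, Nat.coprime_pow_right_iff (by omega), Nat.coprime_comm,
      Nat.Prime.coprime_iff_not_dvd hp.out] at hu
    exact hu hK
  · rw [if_neg hK]
    obtain ⟨u, hu⟩ : IsUnit ((K : ZMod (p ^ s))) := by
      rw [ZMod.isUnit_iff_coprime]
      exact Nat.Coprime.pow_right _ (Nat.coprime_comm.mp ((Nat.Prime.coprime_iff_not_dvd hp.out).mpr hK))
    rw [← hu, Ring.inverse_unit, ZMod.inv_coe_unit]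

/-- Transport of a vanishing sum in `ℤ/p^s` to a `p^s`-divisibility of the weights on the block `[k/p^s] = n`:
if `Σ_{j ∈ S} (p ∣ j ? 0 : j⁻²) = 0` in `ℤ/p^s` (`s ≥ 1`), then `p^s ∣ Σ_{j ∈ S} (np^s + j)⁻²` in `ℤ_p`.
[cite: OsburnSahuStraub2016, Theorem 1.2 (proof, «each of the inner sums … is divisible by p^s»)] -/
theorem pow_dvd_sum_weights_of_zmod {s : ℕ} (hs : 1 ≤ s) (S : Finset ℕ) (n : ℕ)
    (h0 : ∑ j ∈ S, (if p ∣ j then (0 : ZMod (p ^ s)) else ((j : ZMod (p ^ s))⁻¹) ^ 2) = 0) :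
    (p : ℤ_[p]) ^ s ∣ ∑ j ∈ S, (Ring.inverse (((n * p ^ s + j : ℕ) : ℤ_[p]))) ^ 2 := by
  rw [← Ideal.mem_span_singleton, ← PadicInt.ker_toZModPow, RingHom.mem_ker, map_sum]
  rw [← h0]
  refine Finset.sum_congr rfl fun j _ => ?_
  have hj : ((n * p ^ s + j : ℕ) : ZMod (p ^ s)) = (j : ZMod (p ^ s)) := by
    have hps : ((p : ZMod (p ^ s))) ^ s = 0 := by rw [← Nat.cast_pow, ZMod.natCast_self]
    push_cast
    rw [hps, mul_zero, zero_add]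
  rw [map_pow, toZModPow_ringInverse_natCast_oss hs, hj, ringInverse_natCast_zmod_sq hs]

/-- **«each of the inner sums is divisible by `p^s`», lower half**: for `p ≥ 5` and all `s, n`,
`p^s ∣ Σ_{[k/p^s] = n, {k:p^s} < p^s/2} a_k` in `ℤ_p` (`a_k = k⁻²` for `p ∤ k`, `0` otherwise), by (8) of Lemma 2.2.
[cite: OsburnSahuStraub2016, Theorem 1.2 (proof, display (sumCsx)) with Lemma 2.2 (8)] -/
theorem pow_dvd_sum_weights_lower_half (h5 : 5 ≤ p) (s n : ℕ) :
    (p : ℤ_[p]) ^ s ∣ ∑ j ∈ (range (p ^ s)).filter (fun j => 2 * j < p ^ s),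
      (Ring.inverse (((n * p ^ s + j : ℕ) : ℤ_[p]))) ^ 2 := by
  have hp' := hp.out
  rcases Nat.eq_zero_or_pos s with h0 | hs
  · rw [h0, pow_zero]; exact one_dvd _
  refine pow_dvd_sum_weights_of_zmod hs _ n ?_
  have hp2 : p ≠ 2 := by omega
  obtain ⟨h, hh⟩ : Odd (p ^ s) := (hp'.odd_of_ne_two hp2).pow
  have hset : (range (p ^ s)).filter (fun j => 2 * j < p ^ s) = range (p ^ s / 2 + 1) := by
    ext j
    simp only [Finset.mem_filter, Finset.mem_range]
    omega
  rw [hset]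
  exact half_sum_inv_sq_eq_zero h5 hs

/-- **«each of the inner sums is divisible by `p^s`», upper half**: for `p ≥ 5` and all `s, n`,
`p^s ∣ Σ_{[k/p^s] = n, {k:p^s} > p^s/2} a_k` in `ℤ_p` (the full block sum (7) minus the lower half (8)).
[cite: OsburnSahuStraub2016, Theorem 1.2 (proof, display (sumCsx)) with Lemma 2.2 (7), (8)] -/
theorem pow_dvd_sum_weights_upper_half (h5 : 5 ≤ p) (s n : ℕ) :
    (p : ℤ_[p]) ^ s ∣ ∑ j ∈ (range (p ^ s)).filter (fun j => ¬ 2 * j < p ^ s),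
      (Ring.inverse (((n * p ^ s + j : ℕ) : ℤ_[p]))) ^ 2 := by
  rcases Nat.eq_zero_or_pos s with h0 | hs
  · rw [h0, pow_zero]; exact one_dvd _
  have hfull : (p : ℤ_[p]) ^ s ∣ ∑ j ∈ range (p ^ s), (Ring.inverse (((n * p ^ s + j : ℕ) : ℤ_[p]))) ^ 2 :=
    pow_dvd_sum_weights_of_zmod hs _ n (sum_range_inv_sq_eq_zero (p := p) h5 s)
  rw [← Finset.sum_filter_add_sum_filter_not (range (p ^ s)) (fun j => 2 * j < p ^ s)] at hfull
  exact (dvd_add_right (pow_dvd_sum_weights_lower_half h5 s n)).mp hfull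

end Weights

/-! ### §3. Regrouping by `[k/p^s] = n` and the splitting by `[2k/p^s]` -/

section Blocks

/-- «`Σ_k = Σ_n Σ_{[k/p^s] = n}`»: `Σ_{k < ab} f(k) = Σ_{n < a} Σ_{j < b} f(nb + j)`.
[cite: OsburnSahuStraub2016, Theorem 1.2 (proof, display (sumCsx), first equality)] -/
theorem sum_range_mul_eq_sum_sum {M : Type*} [AddCommMonoid M] (f : ℕ → M) (b : ℕ) :
    ∀ a : ℕ, ∑ k ∈ range (a * b), f k = ∑ n ∈ range a, ∑ j ∈ range b, f (n * b + j)
  | 0 => by simp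
  | a + 1 => by
    rw [Nat.succ_mul, Finset.sum_range_add, sum_range_mul_eq_sum_sum f b a, Finset.sum_range_succ]

/-- `[k/p^s] = n` on the block `k = np^s + j`, `0 ≤ j < p^s`. [cite: OsburnSahuStraub2016, Theorem 1.2 (proof, «{k : p^s} := k − p^s[k/p^s]»)] -/
theorem add_div_eq_of_lt {b j : ℕ} (hj : j < b) (n : ℕ) : (n * b + j) / b = n := by
  have hb : 0 < b := by omega
  rw [mul_comm, Nat.mul_add_div hb, Nat.div_eq_of_lt hj, add_zero]

/-- The printed digit identity: «`[2k/p^s] = 2[k/p^s] + 1` if `{k : p^s} > p^s/2`, `= 2[k/p^s]` otherwise» — on the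
block `k = np^s + j`, `[2k/p^s] = 2n + (0 if 2j < p^s else 1)`. [cite: OsburnSahuStraub2016, Theorem 1.2 (proof, display before (sumCsx))] -/
theorem two_mul_add_div_eq_of_lt {b j : ℕ} (hj : j < b) (n : ℕ) :
    2 * (n * b + j) / b = 2 * n + if 2 * j < b then 0 else 1 := by
  have hb : 0 < b := by omega
  rw [show 2 * (n * b + j) = b * (2 * n) + 2 * j by ring, Nat.mul_add_div hb]
  congr 1
  split_ifs with h
  · exact Nat.div_eq_of_lt h
  · exact Nat.div_eq_of_lt_le (by omega) (by omega)

variable {p : ℕ} [hp : Fact p.Prime]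

/-- **One step of the printed induction, abstract form**: for `p ≥ 5`, if `p^e ∣ G(n, j)` in `ℤ_p` for all `n, j`,
then `p^{e+s} ∣ Σ_{k < Mp^s} a_k · G([k/p^s], [2k/p^s])` — regroup by `[k/p^s] = n`, split each block by
`[2k/p^s] ∈ {2n, 2n+1}`, and use that both half-block sums of the weights are divisible by `p^s`.
[cite: OsburnSahuStraub2016, Theorem 1.2 (proof, display (sumCsx) and the following sentence)] -/
theorem pow_dvd_weighted_block_sum (h5 : 5 ≤ p) (s e M : ℕ) (G : ℕ → ℕ → ℤ_[p])
    (hG : ∀ n j, (p : ℤ_[p]) ^ e ∣ G n j) :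
    (p : ℤ_[p]) ^ (e + s) ∣ ∑ k ∈ range (M * p ^ s),
      (Ring.inverse ((k : ℤ_[p]))) ^ 2 * G (k / p ^ s) (2 * k / p ^ s) := by
  rw [sum_range_mul_eq_sum_sum (fun k => (Ring.inverse ((k : ℤ_[p]))) ^ 2 * G (k / p ^ s) (2 * k / p ^ s))
    (p ^ s) M]
  refine Finset.dvd_sum fun n _ => ?_
  have hblock : ∑ j ∈ range (p ^ s), (Ring.inverse (((n * p ^ s + j : ℕ) : ℤ_[p]))) ^ 2 *
        G ((n * p ^ s + j) / p ^ s) (2 * (n * p ^ s + j) / p ^ s) =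
      ∑ j ∈ range (p ^ s), (Ring.inverse (((n * p ^ s + j : ℕ) : ℤ_[p]))) ^ 2 *
        G n (2 * n + if 2 * j < p ^ s then 0 else 1) := by
    refine Finset.sum_congr rfl fun j hj => ?_
    rw [Finset.mem_range] at hj
    rw [add_div_eq_of_lt hj, two_mul_add_div_eq_of_lt hj]
  rw [hblock, ← Finset.sum_filter_add_sum_filter_not (range (p ^ s)) (fun j => 2 * j < p ^ s)]
  have hlow : ∑ j ∈ (range (p ^ s)).filter (fun j => 2 * j < p ^ s),
        (Ring.inverse (((n * p ^ s + j : ℕ) : ℤ_[p]))) ^ 2 * G n (2 * n + if 2 * j < p ^ s then 0 else 1) =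
      (∑ j ∈ (range (p ^ s)).filter (fun j => 2 * j < p ^ s),
        (Ring.inverse (((n * p ^ s + j : ℕ) : ℤ_[p]))) ^ 2) * G n (2 * n) := by
    rw [Finset.sum_mul]
    refine Finset.sum_congr rfl fun j hj => ?_
    rw [(Finset.mem_filter.mp hj).2 |> if_pos, add_zero]
  have hup : ∑ j ∈ (range (p ^ s)).filter (fun j => ¬ 2 * j < p ^ s),
        (Ring.inverse (((n * p ^ s + j : ℕ) : ℤ_[p]))) ^ 2 * G n (2 * n + if 2 * j < p ^ s then 0 else 1) =
      (∑ j ∈ (range (p ^ s)).filter (fun j => ¬ 2 * j < p ^ s),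
        (Ring.inverse (((n * p ^ s + j : ℕ) : ℤ_[p]))) ^ 2) * G n (2 * n + 1) := by
    rw [Finset.sum_mul]
    refine Finset.sum_congr rfl fun j hj => ?_
    rw [(Finset.mem_filter.mp hj).2 |> if_neg]
  rw [hlow, hup, add_comm e s, pow_add]
  exact dvd_add (mul_dvd_mul (pow_dvd_sum_weights_lower_half h5 s n) (hG n _))
    (mul_dvd_mul (pow_dvd_sum_weights_upper_half h5 s n) (hG n _))

end Blocks

end Literature.Combinatorics.Enumerative.SporadicSupercongruenceProofs
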